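import Mathlib
import Literature.MathematicalPhysics.QuantumFieldTheory.Balaban1983to89.B6Prop26

/-!
# `Balaban1983to89.B6Prop26Gluing` — [Balaban1984PropagatorsII] p. 247: *"this together with (2.91) implies
(2.135)"* — the FINITE-OVERLAP GLUING of the per-box bounds (2.133), (2.134) over the partition {h_□} of (2.91)
into the two global majorants consumed by *"Reasoning in the same way as in the proof of Proposition 2.2 we
obtain Proposition 2.6"*, KERNEL-CHECKED

CITATION HEADER (lean-in-tree rule 2026-08-18).  Source: T. Bałaban, *Propagators and renormalization
transformations for lattice gauge theories. II*, Commun. Math. Phys. **96**, 223–250 (1984)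
[Balaban1984PropagatorsII] (cell paper B6; held: `paper:balaban1984-cmp96-propagators-rt-ii`; journal page = PDF
page + 222; every quotation below is read from the page renders pp. 229, 239, 247).  Satellite of the sibling
modules `…Balaban1983to89.B6` (unit r1 / sub-cell b06), `…B6RandomWalk` (unit pv08) and `…B6Prop26` (unit pv01),
which it imports and does not modify; surge node T03.6 "sharpen" (Prop. 2.6), unit `b2b-balaban-pv09` (row owner;
journalled SPLIT: pv08 = the rate-½δ₂ instance `B6RandomWalk.prop26_chain_2136`, pv01 = the fixed-point algebra
`B6Prop26.fixedPoint_of_291` and the left-factor entries, THIS module = the gluing step both take as hypotheses).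

WHAT THE PAPER PRINTS.  p. 239 [PDF 17]: *"We form an approximation of G taking as usual
G₀ = Σ_{□∈𝒟} h_□G_□h_□.  Using the formulas (1.126)–(1.128), we get Δ_aG₀ = I − Σ_{□,□′∈𝒟} K_{□,□′}G_{□′}h_{□′}
= I − R, (2.91)"*, where by (2.92) every term of K_{□,□} carries one of the LEFT factors (∂h_□)(b), b ∈ st(x),
(Δh_□)(x), S_j*(∂h_□), Q_j*S_j(∂h_□), ζ_□, and by (2.93) *"(K_{□,□′}A)_μ(x) = (h_□²(1 − ζ_□)∂P∂*h_{□′}A)_μ(x) if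
□ ≠ □′"*; *"The function ζ_□ is of the same type as h_□, but it is equal to 1 on a cube containing □ and with a
boundary having the distance 1/3M to the boundary of □, and it is equal to 0 outside a similar cube with 1/3M
replaced by 2/3M."*  p. 229 [PDF 7]: *"Σ_□ h_□² = 1 (2.36)"*.  p. 247 [PDF 25]: *"|(G_□J)(x)|, |(∇G_□J)(x)| ≤
O(1)[(L^jη)², L^jη]e^{−δ₂(L^jη)^{−1}dist(Δ,Δ′)}|J|, (2.133) for x ∈ Δ(y), supp J ⊂ Δ(y′), y, y′ ∈ 𝔅 ∩ T_□.
Applying the inequalities (2.133), (2.88) and the remarks after the inequality (2.68) we obtain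
|(K_{□,□′}G_{□′}h_{□′}J)(x)| ≤ O(M^{−1})e^{−½δ₂d(y,y′)}|J| (2.134) for x ∈ Δ(y), supp J ⊂ Δ(y′), and this
together with (2.91) implies |(RJ)(x)| ≤ O(M^{−1})e^{−½δ₂d(y,y′)}|J|, x ∈ Δ(y), supp J ⊂ Δ(y′). (2.135)
Reasoning in the same way as in the proof of Proposition 2.2 we obtain Proposition 2.6."*

WHAT IS REPRODUCED HERE (kernel-checked; every analytic input an explicit hypothesis OF THE PRINTED SHAPE, the
"proof of Prop. 2.2" and the (2.91)-algebra invoked BY NAME from the sibling modules, nothing duplicated).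
The words *"this together with (2.91) implies"* hide a double sum over the pairs (□, □′) ∈ 𝒟 × 𝒟 and the word
*"Reasoning in the same way"* consumes a majorant of the single sum G₀ = Σ_□ h_□G_□h_□; both sums are controlled by
the BOUNDED OVERLAP of the cover {□̃} — each block y ∈ 𝔅 meets the reach of at most N boxes — which the paper
does not display.  Typed on pv08's carrier (`B6RandomWalk.HasMajorant`: a linear operator on the functions on an
abstract finite lattice X with block map `blk : X → 𝔅`):
(1) `mulOp h` — multiplication by a lattice function (the partition functions h_□, the cut-offs ζ_□);
    `abs_le_one_of_sum_sq` — (2.36) Σ_□ h_□(x)² = 1 ⟹ |h_□(x)| ≤ 1;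
(2) localisation: `OutLoc` (the operator's OUTPUT vanishes outside the blocks of a reach set S — from a left factor
    h_□ / ζ_□ / ∂h_□, `outLoc_mulOp_mul`), `InLoc` (the operator KILLS every function supported in a block outside
    S — from the right factor h_{□′}, `inLoc_mul_mulOp`); a global majorant K of a so localised operator improves to
    1_S(y)·1_{S′}(y′)·K(y,y′) (`hasMajorant_localise`);
(3) the gluing: majorants of a finite sum add (`hasMajorant_finsetSum`); if every term's majorant carries the
    indicator 1_{S_□}(y) and each block lies in at most N reach sets, the sum has majorant N·K
    (`hasMajorant_sum_overlap`); for a double sum with 1_{S_□}(y)·1_{S_□′}(y′) the majorant is N²·K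
    (`hasMajorant_sum_pairs_overlap`);
(4) G₀: the printed LOCAL shape of (2.133) — a bound for y, y′ in the reach of ONE box only (`LocalMajorant`) —
    sandwiched as h_□G_□h_□ is a global term with majorant 1_{S_□}(y)1_{S_□}(y′)K (`hasMajorant_sandwich`), hence
    G₀ = Σ_□ h_□G_□h_□ has majorant N·K (`majorant_G0_of_2133`);
(5) R: the per-pair bound (2.134) (valid for all y, y′ as printed) + the left localisation of K_{□,□′} ((2.92),
    (2.93)) + the right factor h_{□′} give R = Σ_{□,□′} K_{□,□′}G_{□′}h_{□′} the majorant N²·O(M^{−1})e^{−½δ₂d(y,y′)}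
    — (2.135) with its O(M^{−1}) = N²·(the O(M^{−1}) of (2.134)) EXPLICIT (`majorant_R_of_2134`,
    `ineq2135_of_2134_291`);
(6) end-to-end, the first entry |(GJ)(x)| of (2.136): `prop26_2136_of_2133_2134` = (4) + (5) + pv01's
    `B6Prop26.fixedPoint_of_291` + pv08's `B6RandomWalk.prop26_chain_2136`, with the constants A ↦ N·A,
    θ ↦ N²θ₀ and hence the LOCATED smallness N²θ₀·c₁(d, ½δ₂, α) < 1 (cell SMALLNESS S-B6.3); and the same with
    Lemma 2.1 taken from the tree at the rate ½δ₂ (`prop26_2136_of_2133_2134_lemma21`).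
WHAT IS *NOT* REPRODUCED OR ASSERTED: (2.133) (Prop. 2.5 rescaled), (2.134) (cell GAPS G-B6-11), (2.91) itself
(B5 (1.126)–(1.128)), the comparison of the scaled euclidean distance (L^jη)^{−1}dist(Δ,Δ′) on T_□ with the
multiscale distance d inside the reach of one box (GAPS G-pv08-1, G-pv01-5 (i)) — (2.133) enters already in
d-form —, the value of the overlap number N of the cover (B5 (1.118) convention; a function of d), the support
inclusions supp h_□ ⊂ □̃, ζ_□ = 0 off the ⅔M-enlargement of □ (hypotheses `hsupp`, `hKout`), and the derivative /
Hölder / L² entries of (2.136)–(2.140).  NOTHING is asserted about the continuum or the summit; value = typed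
skeleton + located gaps, NOT summit progress.  Companion rows: cell `GAPS.md` C-pv09-1, G-pv09-1; `SMALLNESS.md`
S-B6.3.
-/

namespace Literature.MathematicalPhysics.QuantumFieldTheory.Balaban1983to89.B6Prop26Gluing

open Literature.MathematicalPhysics.QuantumFieldTheory.Balaban1983to89
open B6RandomWalk B6Prop26 Finset

variable {g : B6.Geometry} {X : Type}

/-! ## Multiplication operators: the partition functions h_□ and the cut-offs ζ_□ -/

section MulOp

/-- Multiplication by a lattice function h, as a linear operator on the functions on the lattice X (the factors
h_□ of *"G₀ = Σ_{□∈𝒟} h_□G_□h_□"* and h_{□′}, h_□², ζ_□ of (2.91)–(2.93), p. 239). [folklore] -/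
def mulOp (h : X → ℝ) : Module.End ℝ (X → ℝ) where
  toFun v := fun x => h x * v x
  map_add' v w := by
    funext x
    simp only [Pi.add_apply]
    ring
  map_smul' r v := by
    funext x
    simp only [Pi.smul_apply, smul_eq_mul, RingHom.id_apply]
    ring

/-- (hv)(x) = h(x)v(x). [folklore] -/
@[simp] theorem mulOp_apply (h v : X → ℝ) (x : X) : mulOp h v x = h x * v x := rfl

/-- **(2.36) ⟹ |h_□| ≤ 1** (p. 229: *"Σ_□ h_□² = 1 (2.36)"*): each function of a quadratic partition of unity
is bounded by 1 in absolute value. [cite: Balaban1984PropagatorsII, (2.36) p.229] -/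
theorem abs_le_one_of_sum_sq {C : Type} (D : Finset C) (h : C → X → ℝ) (x : X)
    (h236 : ∑ c ∈ D, h c x ^ 2 = 1) (c : C) (hc : c ∈ D) : |h c x| ≤ 1 := by
  have hle : h c x ^ 2 ≤ ∑ c' ∈ D, h c' x ^ 2 :=
    Finset.single_le_sum (f := fun c' => h c' x ^ 2) (fun c' _ => sq_nonneg (h c' x)) hc
  rw [h236] at hle
  exact (sq_le_one_iff_abs_le_one (h c x)).mp hle

/-- A function supported in the block of y′ with bound B stays so after multiplication by h with |h| ≤ 1
(*"supp λ ⊂ B^{j′}(y′)"*, *"|λ|"*). [folklore] -/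
theorem blockSupp_mulOp (blk : X → g.Site) {h μ : X → ℝ} {y' : g.Site} {B : ℝ} (hle : ∀ x, |h x| ≤ 1)
    (hμ : BlockSupp blk μ y' B) : BlockSupp blk (mulOp h μ) y' B := by
  refine ⟨hμ.nonneg, fun x hx => ?_, fun x hx => ?_⟩
  · rw [mulOp_apply, abs_mul]
    calc |h x| * |μ x| ≤ 1 * |μ x| := mul_le_mul_of_nonneg_right (hle x) (abs_nonneg _)
      _ = |μ x| := one_mul _
      _ ≤ B := hμ.bound x hx
  · rw [mulOp_apply, hμ.off x hx, mul_zero]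

/-- If h vanishes outside the blocks of the reach set S (*supp h_□ ⊂ □̃*) and μ is supported in the block of a
point y′ ∉ S, then hμ = 0. [folklore] -/
theorem mulOp_eq_zero_of_blockSupp (blk : X → g.Site) {h μ : X → ℝ} {S : Set g.Site} {y' : g.Site} {B : ℝ}
    (hsupp : ∀ x, h x ≠ 0 → blk x ∈ S) (hμ : BlockSupp blk μ y' B) (hy' : y' ∉ S) : mulOp h μ = 0 := by
  funext x
  rw [mulOp_apply, Pi.zero_apply]
  by_cases hx : blk x = y'
  · have h0 : h x = 0 := by
      by_contra hne
      exact hy' (hx ▸ hsupp x hne)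
    rw [h0, zero_mul]
  · rw [hμ.off x hx, mul_zero]

end MulOp

/-! ## Localisation of an operator to the reach of a box -/

section Localisation

/-- OUTPUT LOCALISATION: (Tv)(x) = 0 for x outside the blocks of S, for every v — the left factors h_□, h_□²,
ζ_□, ∂h_□, Δh_□ of h_□G_□h_□ and of K_{□,□′} in (2.92)–(2.93) are supported in the ⅔M-enlargement of □.
[cite: Balaban1984PropagatorsII, (2.92)–(2.93) p.239] -/
def OutLoc (blk : X → g.Site) (T : Module.End ℝ (X → ℝ)) (S : Set g.Site) : Prop :=
  ∀ (v : X → ℝ) (x : X), blk x ∉ S → T v x = 0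

/-- INPUT LOCALISATION: Tμ = 0 for every μ supported in a block outside S — the right factor h_{□′} of
K_{□,□′}G_{□′}h_{□′} in (2.91) and of h_□G_□h_□. [cite: Balaban1984PropagatorsII, (2.91) p.239] -/
def InLoc (blk : X → g.Site) (T : Module.End ℝ (X → ℝ)) (S : Set g.Site) : Prop :=
  ∀ (y' : g.Site) (μ : X → ℝ) (B : ℝ), BlockSupp blk μ y' B → y' ∉ S → T μ = 0

/-- A left multiplication factor supported over S localises the output. [folklore] -/
theorem outLoc_mulOp_mul (blk : X → g.Site) {h : X → ℝ} {S : Set g.Site} (hsupp : ∀ x, h x ≠ 0 → blk x ∈ S)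
    (T : Module.End ℝ (X → ℝ)) : OutLoc blk (mulOp h * T) S := by
  intro v x hx
  rw [Module.End.mul_apply, mulOp_apply]
  have h0 : h x = 0 := by
    by_contra hne
    exact hx (hsupp x hne)
  rw [h0, zero_mul]

/-- Output localisation survives further right factors. [folklore] -/
theorem outLoc_mul (blk : X → g.Site) {T : Module.End ℝ (X → ℝ)} {S : Set g.Site} (hT : OutLoc blk T S)
    (T' : Module.End ℝ (X → ℝ)) : OutLoc blk (T * T') S := by
  intro v x hx
  rw [Module.End.mul_apply]
  exact hT _ x hx

/-- A right multiplication factor supported over S localises the input. [folklore] -/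
theorem inLoc_mul_mulOp (blk : X → g.Site) (T : Module.End ℝ (X → ℝ)) {h : X → ℝ} {S : Set g.Site}
    (hsupp : ∀ x, h x ≠ 0 → blk x ∈ S) : InLoc blk (T * mulOp h) S := by
  intro y' μ B hμ hy'
  rw [Module.End.mul_apply, mulOp_eq_zero_of_blockSupp blk hsupp hμ hy', map_zero]

/-- Input localisation survives further left factors. [folklore] -/
theorem inLoc_mul (blk : X → g.Site) (T : Module.End ℝ (X → ℝ)) {T' : Module.End ℝ (X → ℝ)} {S : Set g.Site}
    (hT' : InLoc blk T' S) : InLoc blk (T * T') S := by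
  intro y' μ B hμ hy'
  rw [Module.End.mul_apply, hT' y' μ B hμ hy', map_zero]

open Classical in
/-- The indicator weight 1_S(y) of a reach set (bookkeeping device for the overlap count). [folklore] -/
noncomputable def ind (S : Set g.Site) (a : g.Site) : ℝ := if a ∈ S then 1 else 0

/-- 1_S ≥ 0. [folklore] -/
theorem ind_nonneg (S : Set g.Site) (a : g.Site) : 0 ≤ ind S a := by
  unfold ind
  split_ifs <;> norm_num

/-- 1_S ≤ 1. [folklore] -/
theorem ind_le_one (S : Set g.Site) (a : g.Site) : ind S a ≤ 1 := by
  unfold ind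
  split_ifs <;> norm_num

/-- 1_S = 1 on S. [folklore] -/
theorem ind_of_mem {S : Set g.Site} {a : g.Site} (h : a ∈ S) : ind S a = 1 := by
  unfold ind
  rw [if_pos h]

/-- 1_S = 0 off S. [folklore] -/
theorem ind_of_not_mem {S : Set g.Site} {a : g.Site} (h : a ∉ S) : ind S a = 0 := by
  unfold ind
  rw [if_neg h]

open Classical in
/-- Σ_□ 1_{S_□}(y) = #{□ ∈ 𝒟 : y ∈ S_□} — the number of boxes whose reach contains the block y. [folklore] -/
theorem sum_ind_eq_card {C : Type} (D : Finset C) (S : C → Set g.Site) (a : g.Site) :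
    ∑ c ∈ D, ind (S c) a = ((D.filter fun c => a ∈ S c).card : ℝ) := by
  rw [Finset.natCast_card_filter]
  refine Finset.sum_congr rfl fun c _ => ?_
  unfold ind
  split_ifs <;> simp

/-- A global majorant K ≥ 0 of an operator localised in output to S and in input to S′ improves to
1_S(y)·1_{S′}(y′)·K(y,y′). [folklore] -/
theorem hasMajorant_localise (blk : X → g.Site) {T : Module.End ℝ (X → ℝ)} {K : g.Site → g.Site → ℝ}
    {S S' : Set g.Site} (hT : HasMajorant blk T K) (hK : ∀ a b, 0 ≤ K a b) (hout : OutLoc blk T S)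
    (hin : InLoc blk T S') : HasMajorant blk T (fun a b => ind S a * ind S' b * K a b) := by
  intro y' μ B hμ x
  beta_reduce
  have hnn : 0 ≤ ind S (blk x) * ind S' y' * K (blk x) y' * B :=
    mul_nonneg (mul_nonneg (mul_nonneg (ind_nonneg _ _) (ind_nonneg _ _)) (hK _ _)) hμ.nonneg
  by_cases hx : blk x ∈ S
  · by_cases hy : y' ∈ S'
    · rw [ind_of_mem hx, ind_of_mem hy, one_mul, one_mul]
      exact hT y' μ B hμ x
    · have h0 : T μ x = 0 := by rw [hin y' μ B hμ hy, Pi.zero_apply]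
      rw [h0, abs_zero]
      exact hnn
  · rw [hout μ x hx, abs_zero]
    exact hnn

end Localisation

/-! ## Gluing finite sums with bounded overlap -/

section Gluing

/-- Majorants of a finite family of operators add up over any finite index set (*"A summation preserves it
also"*, p. 232). [cite: Balaban1984PropagatorsII, p.232] -/
theorem hasMajorant_finsetSum (blk : X → g.Site) {C : Type} (D : Finset C) (T : C → Module.End ℝ (X → ℝ))
    (K : C → g.Site → g.Site → ℝ) (h : ∀ c ∈ D, HasMajorant blk (T c) (K c)) :
    HasMajorant blk (∑ c ∈ D, T c) (fun a b => ∑ c ∈ D, K c a b) := by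
  intro y' μ B hμ x
  beta_reduce
  rw [LinearMap.sum_apply, Finset.sum_apply, Finset.sum_mul]
  exact (Finset.abs_sum_le_sum_abs _ _).trans (Finset.sum_le_sum fun c hc => h c hc y' μ B hμ x)

open Classical in
/-- **Bounded-overlap gluing, single sum** (the step behind *"G₀ = Σ_□ h_□G_□h_□"* having a global majorant): if
every term T_□ has majorant 1_{S_□}(y)·K(y,y′) with a common K ≥ 0 and every block y lies in the reach S_□ of at
most N boxes, then Σ_□ T_□ has majorant N·K. [folklore] -/
theorem hasMajorant_sum_overlap (blk : X → g.Site) {C : Type} (D : Finset C) (S : C → Set g.Site)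
    (T : C → Module.End ℝ (X → ℝ)) (K : g.Site → g.Site → ℝ) (hK : ∀ a b, 0 ≤ K a b)
    (hT : ∀ c ∈ D, HasMajorant blk (T c) (fun a b => ind (S c) a * K a b))
    (N : ℕ) (hN : ∀ a : g.Site, (D.filter fun c => a ∈ S c).card ≤ N) :
    HasMajorant blk (∑ c ∈ D, T c) (fun a b => N * K a b) := by
  refine hasMajorant_mono blk (hasMajorant_finsetSum blk D T _ hT) fun a b => ?_
  show ∑ c ∈ D, ind (S c) a * K a b ≤ N * K a b
  rw [← Finset.sum_mul, sum_ind_eq_card]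
  exact mul_le_mul_of_nonneg_right (by exact_mod_cast hN a) (hK a b)

open Classical in
/-- **Bounded-overlap gluing, double sum** (the step behind *"this together with (2.91) implies (2.135)"*): if
every term T_{□,□′} has majorant 1_{S_□}(y)·1_{S_□′}(y′)·K(y,y′) with a common K ≥ 0 and every block lies in at
most N reach sets, then Σ_{□,□′} T_{□,□′} has majorant N²·K. [folklore] -/
theorem hasMajorant_sum_pairs_overlap (blk : X → g.Site) {C : Type} (D : Finset C) (S : C → Set g.Site)
    (T : C → C → Module.End ℝ (X → ℝ)) (K : g.Site → g.Site → ℝ) (hK : ∀ a b, 0 ≤ K a b)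
    (hT : ∀ c ∈ D, ∀ c' ∈ D, HasMajorant blk (T c c') (fun a b => ind (S c) a * ind (S c') b * K a b))
    (N : ℕ) (hN : ∀ a : g.Site, (D.filter fun c => a ∈ S c).card ≤ N) :
    HasMajorant blk (∑ c ∈ D, ∑ c' ∈ D, T c c') (fun a b => (N : ℝ) ^ 2 * K a b) := by
  have hNa : ∀ a : g.Site, ∑ c ∈ D, ind (S c) a ≤ N := fun a => by
    rw [sum_ind_eq_card]
    exact_mod_cast hN a
  have hinner : ∀ c ∈ D,
      HasMajorant blk (∑ c' ∈ D, T c c') (fun a b => ind (S c) a * ((N : ℝ) * K a b)) := by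
    intro c hc
    refine hasMajorant_mono blk (hasMajorant_finsetSum blk D (T c) _ (hT c hc)) fun a b => ?_
    show ∑ c' ∈ D, ind (S c) a * ind (S c') b * K a b ≤ ind (S c) a * ((N : ℝ) * K a b)
    have hre : ∑ c' ∈ D, ind (S c) a * ind (S c') b * K a b =
        ind (S c) a * ((∑ c' ∈ D, ind (S c') b) * K a b) := by
      rw [Finset.sum_mul, Finset.mul_sum]
      exact Finset.sum_congr rfl fun c' _ => by ring
    rw [hre]
    exact mul_le_mul_of_nonneg_left (mul_le_mul_of_nonneg_right (hNa b) (hK a b)) (ind_nonneg _ _)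
  refine hasMajorant_mono blk (hasMajorant_finsetSum blk D (fun c => ∑ c' ∈ D, T c c') _ hinner) fun a b => ?_
  show ∑ c ∈ D, ind (S c) a * ((N : ℝ) * K a b) ≤ (N : ℝ) ^ 2 * K a b
  rw [← Finset.sum_mul]
  calc (∑ c ∈ D, ind (S c) a) * ((N : ℝ) * K a b) ≤ (N : ℝ) * ((N : ℝ) * K a b) :=
        mul_le_mul_of_nonneg_right (hNa a) (mul_nonneg (Nat.cast_nonneg N) (hK a b))
    _ = (N : ℝ) ^ 2 * K a b := by ring

end Gluing

/-! ## G₀ = Σ_□ h_□G_□h_□ from the per-box bound (2.133) -/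

section GZero

/-- The printed LOCAL shape of (2.133): *"for x ∈ Δ(y), supp J ⊂ Δ(y′), y, y′ ∈ 𝔅 ∩ T_□"* — a majorant K of the
box operator G_□ (transported to the global lattice X in any way; only its values sandwiched between h_□'s are
used) required ONLY for y, y′ in the reach S of the box. [cite: Balaban1984PropagatorsII, (2.133) p.247] -/
def LocalMajorant (blk : X → g.Site) (T : Module.End ℝ (X → ℝ)) (S : Set g.Site)
    (K : g.Site → g.Site → ℝ) : Prop :=
  ∀ y' ∈ S, ∀ (μ : X → ℝ) (B : ℝ), BlockSupp blk μ y' B → ∀ x : X, blk x ∈ S → |T μ x| ≤ K (blk x) y' * B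

/-- A global majorant is in particular a local one on every reach set. [folklore] -/
theorem localMajorant_of_hasMajorant (blk : X → g.Site) {T : Module.End ℝ (X → ℝ)} {K : g.Site → g.Site → ℝ}
    (h : HasMajorant blk T K) (S : Set g.Site) : LocalMajorant blk T S K :=
  fun y' _ μ B hμ x _ => h y' μ B hμ x

/-- **The sandwich h_□G_□h_□** (p. 239 *"G₀ = Σ_{□∈𝒟} h_□G_□h_□"*): a LOCAL majorant K ≥ 0 of G_□ on the reach S
of the box, |h_□| ≤ 1 ((2.36)) and supp h_□ inside the blocks of S give the GLOBAL majorant 1_S(y)·1_S(y′)·K(y,y′)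
of h_□G_□h_□. [cite: Balaban1984PropagatorsII, (2.90)–(2.91) p.239 + (2.133) p.247] -/
theorem hasMajorant_sandwich (blk : X → g.Site) {Gl : Module.End ℝ (X → ℝ)} {h : X → ℝ} {S : Set g.Site}
    {K : g.Site → g.Site → ℝ} (hK : ∀ a b, 0 ≤ K a b) (hsupp : ∀ x, h x ≠ 0 → blk x ∈ S)
    (hle : ∀ x, |h x| ≤ 1) (hG : LocalMajorant blk Gl S K) :
    HasMajorant blk (mulOp h * Gl * mulOp h) (fun a b => ind S a * ind S b * K a b) := by
  intro y' μ B hμ x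
  beta_reduce
  have hnn : 0 ≤ ind S (blk x) * ind S y' * K (blk x) y' * B :=
    mul_nonneg (mul_nonneg (mul_nonneg (ind_nonneg _ _) (ind_nonneg _ _)) (hK _ _)) hμ.nonneg
  rw [Module.End.mul_apply, Module.End.mul_apply, mulOp_apply]
  by_cases hx : h x = 0
  · rw [hx, zero_mul, abs_zero]
    exact hnn
  have hxS : blk x ∈ S := hsupp x hx
  by_cases hy : y' ∈ S
  · rw [ind_of_mem hxS, ind_of_mem hy, one_mul, one_mul, abs_mul]
    calc |h x| * |Gl (mulOp h μ) x| ≤ 1 * |Gl (mulOp h μ) x| :=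
          mul_le_mul_of_nonneg_right (hle x) (abs_nonneg _)
      _ = |Gl (mulOp h μ) x| := one_mul _
      _ ≤ K (blk x) y' * B := hG y' hy (mulOp h μ) B (blockSupp_mulOp blk hle hμ) x hxS
  · rw [mulOp_eq_zero_of_blockSupp blk hsupp hμ hy, map_zero, Pi.zero_apply, mul_zero, abs_zero]
    exact hnn

open Classical in
/-- **(2.133) per box ⟹ a global majorant of G₀ = Σ_□ h_□G_□h_□** (the input `hG0` of
`B6RandomWalk.prop26_chain_2136` / `hDG0` of `B6Prop26.prop26_entry_of_291`, there a hypothesis): with the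
per-box local majorants K (the d-form of (2.133): K(y,y′) = O(1)(L^jη)²e^{−½δ₂d(y,y′)}), |h_□| ≤ 1, supp h_□ within
the blocks of the reach S_□ and the overlap number N of the reaches, G₀ has majorant N·K.
[cite: Balaban1984PropagatorsII, (2.90)–(2.91) p.239 + (2.133) p.247] -/
theorem majorant_G0_of_2133 (blk : X → g.Site) {C : Type} (D : Finset C) (S : C → Set g.Site) (N : ℕ)
    (hN : ∀ a : g.Site, (D.filter fun c => a ∈ S c).card ≤ N)
    (h : C → X → ℝ) (hsupp : ∀ c ∈ D, ∀ x, h c x ≠ 0 → blk x ∈ S c) (hle : ∀ c ∈ D, ∀ x, |h c x| ≤ 1)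
    (Gl : C → Module.End ℝ (X → ℝ)) (K : g.Site → g.Site → ℝ) (hK : ∀ a b, 0 ≤ K a b)
    (h2133 : ∀ c ∈ D, LocalMajorant blk (Gl c) (S c) K) :
    HasMajorant blk (∑ c ∈ D, mulOp (h c) * Gl c * mulOp (h c)) (fun a b => N * K a b) := by
  refine hasMajorant_sum_overlap blk D S _ K hK (fun c hc => ?_) N hN
  refine hasMajorant_mono blk (hasMajorant_sandwich blk hK (hsupp c hc) (hle c hc) (h2133 c hc)) fun a b => ?_
  show ind (S c) a * ind (S c) b * K a b ≤ ind (S c) a * K a b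
  calc ind (S c) a * ind (S c) b * K a b ≤ ind (S c) a * 1 * K a b :=
        mul_le_mul_of_nonneg_right (mul_le_mul_of_nonneg_left (ind_le_one _ _) (ind_nonneg _ _)) (hK a b)
    _ = ind (S c) a * K a b := by rw [mul_one]

end GZero

/-! ## (2.134) *"together with (2.91) implies"* (2.135) -/

section RSum

open Classical in
/-- **(2.134) + (2.91) ⟹ (2.135), KERNEL-CHECKED** (p. 247 *"this together with (2.91) implies |(RJ)(x)| ≤
O(M^{−1})e^{−½δ₂d(y,y′)}|J|"*): if every pair term K_{□,□′}G_{□′}·h_{□′} has the majorant K ((2.134): K(y,y′) =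
O(M^{−1})e^{−½δ₂d(y,y′)} for ALL y, y′), the factor K_{□,□′}G_{□′} is output-localised to the reach S_□ ((2.92):
left factors ∂h_□, Δh_□, ζ_□; (2.93): h_□²) and supp h_{□′} lies within the blocks of S_□′, then
R = Σ_{□,□′∈𝒟} K_{□,□′}G_{□′}h_{□′} has the majorant N²·K, N the overlap number of the reaches.
[cite: Balaban1984PropagatorsII, (2.91)–(2.93) p.239 + (2.134)–(2.135) p.247] -/
theorem majorant_R_of_2134 (blk : X → g.Site) {C : Type} (D : Finset C) (S : C → Set g.Site) (N : ℕ)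
    (hN : ∀ a : g.Site, (D.filter fun c => a ∈ S c).card ≤ N)
    (h : C → X → ℝ) (hsupp : ∀ c ∈ D, ∀ x, h c x ≠ 0 → blk x ∈ S c)
    (Kt : C → C → Module.End ℝ (X → ℝ)) (K : g.Site → g.Site → ℝ) (hK : ∀ a b, 0 ≤ K a b)
    (h2134 : ∀ c ∈ D, ∀ c' ∈ D, HasMajorant blk (Kt c c' * mulOp (h c')) K)
    (hKout : ∀ c ∈ D, ∀ c' ∈ D, OutLoc blk (Kt c c') (S c)) :
    HasMajorant blk (∑ c ∈ D, ∑ c' ∈ D, Kt c c' * mulOp (h c')) (fun a b => (N : ℝ) ^ 2 * K a b) := by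
  refine hasMajorant_sum_pairs_overlap blk D S _ K hK (fun c hc c' hc' => ?_) N hN
  exact hasMajorant_localise blk (h2134 c hc c' hc') hK (outLoc_mul blk (hKout c hc c' hc') _)
    (inLoc_mul_mulOp blk (Kt c c') (hsupp c' hc'))

open Classical in
/-- **(2.135) as printed, with its constant explicit**: under (2.134) with constant θ₀ = O(M^{−1}) at the rate ½δ₂,
R of (2.91) satisfies |(RJ)(x)| ≤ N²θ₀·e^{−½δ₂d(y,y′)}|J| for x ∈ Δ(y), supp J ⊂ Δ(y′) — the printed O(M^{−1})
of (2.135) is N²·(the O(M^{−1}) of (2.134)), N = N(d) the overlap number of the cover (LOCATED, cell GAPS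
G-pv09-1). [cite: Balaban1984PropagatorsII, (2.134)–(2.135) p.247] -/
theorem ineq2135_of_2134_291 (blk : X → g.Site) {C : Type} (D : Finset C) (S : C → Set g.Site) (N : ℕ)
    (hN : ∀ a : g.Site, (D.filter fun c => a ∈ S c).card ≤ N)
    (h : C → X → ℝ) (hsupp : ∀ c ∈ D, ∀ x, h c x ≠ 0 → blk x ∈ S c)
    (Kt : C → C → Module.End ℝ (X → ℝ)) (δ₂ θ₀ : ℝ) (hθ₀ : 0 ≤ θ₀)
    (h2134 : ∀ c ∈ D, ∀ c' ∈ D,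
      HasMajorant blk (Kt c c' * mulOp (h c')) (fun a b => θ₀ * Real.exp (-(δ₂ / 2 * g.dist a b))))
    (hKout : ∀ c ∈ D, ∀ c' ∈ D, OutLoc blk (Kt c c') (S c))
    {R : Module.End ℝ (X → ℝ)} (h291 : R = ∑ c ∈ D, ∑ c' ∈ D, Kt c c' * mulOp (h c')) :
    HasMajorant blk R (fun a b => (N : ℝ) ^ 2 * θ₀ * Real.exp (-(δ₂ / 2 * g.dist a b))) := by
  rw [h291]
  refine hasMajorant_mono blk (majorant_R_of_2134 blk D S N hN h hsupp Kt _
    (fun a b => mul_nonneg hθ₀ (Real.exp_nonneg _)) h2134 hKout) fun a b => le_of_eq ?_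
  ring

end RSum

/-! ## End to end: the first entry of (2.136) from (2.133), (2.134), (2.91) and Lemma 2.1 -/

section EndToEnd

open Classical in
/-- **Prop. 2.6, entry |(GJ)(x)| of (2.136), from the PER-BOX inputs** (p. 247): on a finite lattice X with block
map to 𝔅, boxes 𝒟 with reaches S_□ of overlap number N, partition functions h_□ (|h_□| ≤ 1, supported within
the blocks of S_□), box operators G_□ with the d-form local bound (2.133) A·P(y)·e^{−½δ₂d(y,y′)} for y, y′ ∈ S_□,
pair operators K_{□,□′}G_{□′} output-localised to S_□ with (2.134) |(K_{□,□′}G_{□′}h_{□′}J)(x)| ≤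
θ₀e^{−½δ₂d(y,y′)}|J|, G₀ = Σ_□ h_□G_□h_□ and R = Σ_{□,□′} K_{□,□′}G_{□′}h_{□′} with (2.91) Δ_aG₀ = I − R and
GΔ_a = I: then — given Lemma 2.1 at the rate ½δ₂ ((2.61), (2.63)), (2.54), d(y,y) = 0, d ≥ 0 and the LOCATED
smallness N²θ₀·c₁(d, ½δ₂, α) < 1 — G has the majorant `const2136 d δ₂ α (N²θ₀) (N·A)`·P(y)·e^{−δ₃d(y,y′)},
δ₃ = `delta3 α δ₂` = (1−α)·½δ₂.  Assembly of `majorant_G0_of_2133`, `ineq2135_of_2134_291`, pv01's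
`B6Prop26.fixedPoint_of_291` and pv08's `B6RandomWalk.prop26_chain_2136`, all by name.
[cite: Balaban1984PropagatorsII, Prop. 2.6 (2.136) p.247; (2.91) p.239; (2.133)–(2.135) p.247] -/
theorem prop26_2136_of_2133_2134 [Fintype X] [DecidableEq X] (blk : X → g.Site) (d : ℕ) (δ₂ α θ₀ A : ℝ)
    (P : g.Site → ℝ) (hA : 0 ≤ A) (hP : ∀ y, 0 ≤ P y) (hθ₀ : 0 ≤ θ₀) (hα : α ≤ 1) (hδ₂ : 0 ≤ δ₂)
    (htri : Triangle254 g) (hrefl : ∀ y : g.Site, g.dist y y = 0) (hdnn : ∀ y y' : g.Site, 0 ≤ g.dist y y')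
    (h261 : Ineq261 d g (δ₂ / 2) α) (h263 : Ineq263 d g (δ₂ / 2) α)
    {C : Type} (D : Finset C) (S : C → Set g.Site) (N : ℕ)
    (hN : ∀ a : g.Site, (D.filter fun c => a ∈ S c).card ≤ N)
    (hsmall : (N : ℝ) ^ 2 * θ₀ * B6.c1 d (δ₂ / 2) α < 1)
    (h : C → X → ℝ) (hsupp : ∀ c ∈ D, ∀ x, h c x ≠ 0 → blk x ∈ S c) (hle : ∀ c ∈ D, ∀ x, |h c x| ≤ 1)
    (Gl : C → Module.End ℝ (X → ℝ))
    (h2133 : ∀ c ∈ D,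
      LocalMajorant blk (Gl c) (S c) (fun a b => A * P a * Real.exp (-(δ₂ / 2 * g.dist a b))))
    (Kt : C → C → Module.End ℝ (X → ℝ))
    (h2134 : ∀ c ∈ D, ∀ c' ∈ D,
      HasMajorant blk (Kt c c' * mulOp (h c')) (fun a b => θ₀ * Real.exp (-(δ₂ / 2 * g.dist a b))))
    (hKout : ∀ c ∈ D, ∀ c' ∈ D, OutLoc blk (Kt c c') (S c))
    {G G0 R Δa : Module.End ℝ (X → ℝ)}
    (hG0 : G0 = ∑ c ∈ D, mulOp (h c) * Gl c * mulOp (h c))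
    (hR : R = ∑ c ∈ D, ∑ c' ∈ D, Kt c c' * mulOp (h c'))
    (hinv : G * Δa = 1) (h291 : Δa * G0 = 1 - R) :
    HasMajorant blk G (fun a b => const2136 d δ₂ α ((N : ℝ) ^ 2 * θ₀) (N * A) * P a *
      Real.exp (-(delta3 α δ₂ * g.dist a b))) := by
  have hK : ∀ a b, 0 ≤ A * P a * Real.exp (-(δ₂ / 2 * g.dist a b)) := fun a b =>
    mul_nonneg (mul_nonneg hA (hP a)) (Real.exp_nonneg _)
  have hG0m : HasMajorant blk G0 (fun a b => N * A * P a * Real.exp (-(δ₂ / 2 * g.dist a b))) := by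
    rw [hG0]
    refine hasMajorant_mono blk (majorant_G0_of_2133 blk D S N hN h hsupp hle Gl _ hK h2133)
      fun a b => le_of_eq ?_
    ring
  have hRm : HasMajorant blk R (fun a b => (N : ℝ) ^ 2 * θ₀ * Real.exp (-(δ₂ / 2 * g.dist a b))) :=
    ineq2135_of_2134_291 blk D S N hN h hsupp Kt δ₂ θ₀ hθ₀ h2134 hKout hR
  have hfix : G = G0 + G * R := fixedPoint_of_291 hinv h291
  exact prop26_chain_2136 blk d δ₂ α ((N : ℝ) ^ 2 * θ₀) (N * A) P (mul_nonneg (Nat.cast_nonneg N) hA) hP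
    (mul_nonneg (sq_nonneg _) hθ₀) hα hδ₂ htri hrefl hdnn h261 h263 hsmall hG0m hRm hfix

open Classical in
/-- The same with **Lemma 2.1 taken from the tree at the rate ½δ₂**: for a geometry of a family satisfying
`B6.Lemma21Printed d (δ₂/2) geo` and the triangle inequality (2.54), under (2.1)–(2.2), 0 < α < 1 and (2.59) at
that rate, the inputs (2.61), (2.63) are DISCHARGED (`B6RandomWalk.lemma21Printed_iff`, `ineq263_of_261`).
[cite: Balaban1984PropagatorsII, Prop. 2.6 p.247; Lemma 2.1 p.234] -/
theorem prop26_2136_of_2133_2134_lemma21 {I : Type} (d : ℕ) (δ₂ : ℝ) (hδ₂ : 0 ≤ δ₂) (geo : I → B6.Geometry)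
    (h21 : B6.Lemma21Printed d (δ₂ / 2) geo) (i : I) (htri : Triangle254 (geo i))
    (hrefl : ∀ y : (geo i).Site, (geo i).dist y y = 0) (hdnn : ∀ y y' : (geo i).Site, 0 ≤ (geo i).dist y y')
    (hH : (geo i).Hyp21_22) (α : ℝ) (hα0 : 0 < α) (hα1 : α < 1)
    (h259 : B6.Cond259 d (δ₂ / 2) α (geo i).R (geo i).M)
    {X : Type} [Fintype X] [DecidableEq X] (blk : X → (geo i).Site) (θ₀ A : ℝ) (P : (geo i).Site → ℝ)
    (hA : 0 ≤ A) (hP : ∀ y, 0 ≤ P y) (hθ₀ : 0 ≤ θ₀)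
    {C : Type} (D : Finset C) (S : C → Set (geo i).Site) (N : ℕ)
    (hN : ∀ a : (geo i).Site, (D.filter fun c => a ∈ S c).card ≤ N)
    (hsmall : (N : ℝ) ^ 2 * θ₀ * B6.c1 d (δ₂ / 2) α < 1)
    (h : C → X → ℝ) (hsupp : ∀ c ∈ D, ∀ x, h c x ≠ 0 → blk x ∈ S c) (hle : ∀ c ∈ D, ∀ x, |h c x| ≤ 1)
    (Gl : C → Module.End ℝ (X → ℝ))
    (h2133 : ∀ c ∈ D,
      LocalMajorant blk (Gl c) (S c) (fun a b => A * P a * Real.exp (-(δ₂ / 2 * (geo i).dist a b))))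
    (Kt : C → C → Module.End ℝ (X → ℝ))
    (h2134 : ∀ c ∈ D, ∀ c' ∈ D,
      HasMajorant blk (Kt c c' * mulOp (h c')) (fun a b => θ₀ * Real.exp (-(δ₂ / 2 * (geo i).dist a b))))
    (hKout : ∀ c ∈ D, ∀ c' ∈ D, OutLoc blk (Kt c c') (S c))
    {G G0 R Δa : Module.End ℝ (X → ℝ)}
    (hG0 : G0 = ∑ c ∈ D, mulOp (h c) * Gl c * mulOp (h c))
    (hR : R = ∑ c ∈ D, ∑ c' ∈ D, Kt c c' * mulOp (h c'))
    (hinv : G * Δa = 1) (h291 : Δa * G0 = 1 - R) :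
    HasMajorant blk G (fun a b => const2136 d δ₂ α ((N : ℝ) ^ 2 * θ₀) (N * A) * P a *
      Real.exp (-(delta3 α δ₂ * (geo i).dist a b))) := by
  have h261 : Ineq261 d (geo i) (δ₂ / 2) α :=
    ((lemma21Printed_iff d (δ₂ / 2) geo).mp h21 i hH α hα0 hα1 h259).2
  have h263 : Ineq263 d (geo i) (δ₂ / 2) α :=
    ineq263_of_261 d (geo i) (δ₂ / 2) α htri (by linarith) hα1.le h261
  exact prop26_2136_of_2133_2134 blk d δ₂ α θ₀ A P hA hP hθ₀ hα1.le hδ₂ htri hrefl hdnn h261 h263 D S N hN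
    hsmall h hsupp hle Gl h2133 Kt h2134 hKout hG0 hR hinv h291

end EndToEnd

end Literature.MathematicalPhysics.QuantumFieldTheory.Balaban1983to89.B6Prop26Gluing
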